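import Summits.FinalStateConjecture.FinalStateConjecture.Theorems.PhotonSphereChannelsChannelsResolveTameDevelopmentsRGlobalCloseness
import HarnessLib

/-!
# `ChannelsResolveTameDevelopmentsR` (K2R, stmt-FinalStateConjecture-14075), line `kerr-isolation-dichotomy` —
# negative-side lemma: stub S2 `stub_kerrIsolation` is refuted by any exactly-Kerr silent tame end with a
# CLOSURE point of positive window deviation (lead c2, 2026-08-16)

Over the landed vocabulary (`KerrDevDefs`, `TameHullDefs`; namespace `…Theorems.TameHull`). The registered stub S2
of the line (skeleton `Cruxes/ChannelsResolveTameDevelopmentsR/Lines/kerr_isolation_dichotomy.lean`, statement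
`KerrIsolation`, inlined verbatim below) ends with the conjunct `∀ p ∈ closure E.doc, ∀ R, kerrDev 𝓢 p R = 0`. This file
records, kernel-checked, that the conjunct makes S2 refutable by ONE development-free witness: a `(Λ, r₀)`-tame, silent
end `E` of a spacetime `𝓢` whose d.o.c. is EXACTLY a box Kerr exterior (`E.IsGloballyClose M a 0`, equivalently
`IsKerrDoc 𝓢 E.doc M a`, landed `stub_isGloballyClose_zero_iff_isKerrDoc`) together with a point `p ∈ closure E.doc` and a
scale `R` at which `kerrDev 𝓢 p R ≠ 0` (`kerrIsolation_false_of_closureWitness`). Exact closeness is `δ₀`-closeness for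
every `δ₀` (`stub_isGloballyClose_mono`), so the witness meets S2's hypothesis whatever `δ₀` S2 chooses.

Paper witness (lead c2's dead note `Lines/kerr-isolation-dichotomy-dead.md`, S1 worker's evidence file §(4)): maximal
(Kruskal) Schwarzschild — or any two-ended member — with a small smooth vacuum perturbation supported in the SECOND exterior:
end 1 is exactly Schwarzschild on `doc₁ ∪ H⁺₁` (causally disconnected from the perturbation), tame and silent, while at
`p ∈ H⁺₁ ⊂ closure doc₁` every anchored window of Euclidean size `R` is a neighbourhood of `p` reaching a depth `~R/2` into the
perturbed interior, and at past-horizon / bifurcate points of `closure doc₁` no ingoing-oriented exterior window approximates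
at all. The honest part of the conjunct — `p ∈ E.doc` — is a theorem for exact models (landed `…RKerrDevExactModels.lean`,
p119808). Repair recorded for re-lining: restrict base points to `E.doc ∪ E.horizon` AND control the interior collar
(hull provenance or an explicit collar-silence clause). No new definitions.
-/

noncomputable section

set_option maxSynthPendingDepth 3
set_option linter.dupNamespace false

open Set Filter Function TopologicalSpace Manifold Bundle
open scoped Topology Manifold ContDiff ENNReal NNReal

namespace Summit.FinalStateConjecture.FinalStateConjecture.Theorems.ChannelsResolveTameDevelopmentsR.Negative

open Literature.Geometry.Lorentzian
open Summit.FinalStateConjecture.FinalStateConjecture.Theorems.TameHull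

/-- **A closure-point witness refutes stub S2 (`KerrIsolation`, inlined verbatim as the negated statement).** If some
tameness class `(Λ, r₀)`, `0 < r₀`, and some admissible box `m₀ ≤ M ≤ M₁`, `|a| ≤ (1 − θ)M` (`0 < m₀`, `0 < θ`) admit a
`(Λ, r₀)`-tame SILENT end `E` of a spacetime `𝓢` which is globally `0`-close to the Kerr exterior `(M, a)` and a point
`p ∈ closure E.doc` with `kerrDev 𝓢 p R ≠ 0` for some `R`, then S2 is false: S2's `δ₀` for these parameters applies to
`E` (exact closeness is `δ₀`-closeness, `stub_isGloballyClose_mono`) and forces `kerrDev 𝓢 p R = 0`. [folklore] -/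
theorem kerrIsolation_false_of_closureWitness
    (hW : ∃ (Λ : ℝ≥0) (r₀ : ℝ), 0 < r₀ ∧ ∃ (m₀ M₁ θ : ℝ), 0 < m₀ ∧ 0 < θ ∧
      ∃ (𝓢 : Spacetime.{0} 4) (E : EndDatum 𝓢) (M a : ℝ), E.IsTameEnd Λ r₀ ∧ E.IsSilent ∧
        m₀ ≤ M ∧ M ≤ M₁ ∧ |a| ≤ (1 - θ) * M ∧ E.IsGloballyClose M a 0 ∧
          ∃ p ∈ closure E.doc, ∃ R : ℝ, kerrDev 𝓢 p R ≠ 0) :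
    ¬ ∀ (Λ : ℝ≥0) (r₀ : ℝ), 0 < r₀ → ∀ (m₀ M₁ θ : ℝ), 0 < m₀ → 0 < θ →
      ∃ δ₀ : ℝ≥0∞, 0 < δ₀ ∧ ∀ (𝓢 : Spacetime.{0} 4) (E : EndDatum 𝓢), E.IsTameEnd Λ r₀ →
        E.IsSilent →
          ((∃ M a : ℝ, m₀ ≤ M ∧ M ≤ M₁ ∧ |a| ≤ (1 - θ) * M ∧ E.IsGloballyClose M a δ₀) ∨
              E.IsGloballyFlat δ₀) →
            ((∃ M a : ℝ, 0 < M ∧ |a| < M ∧ IsKerrDoc 𝓢 E.doc M a) ∨ IsMinkowski 𝓢) ∧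
              ∀ p ∈ closure E.doc, ∀ R : ℝ, kerrDev 𝓢 p R = 0 := by
  intro hS2
  obtain ⟨Λ, r₀, hr₀, m₀, M₁, θ, hm₀, hθ, 𝓢, E, M, a, htame, hsil, hmM, hMM, ha, hclose, p, hp, R, hR⟩ := hW
  obtain ⟨δ₀, _hδ₀, hiso⟩ := hS2 Λ r₀ hr₀ m₀ M₁ θ hm₀ hθ
  have hδ : E.IsGloballyClose M a δ₀ := stub_isGloballyClose_mono E hclose (zero_le : (0 : ℝ≥0∞) ≤ δ₀)
  exact hR ((hiso 𝓢 E htame hsil (Or.inl ⟨M, a, hmM, hMM, ha, hδ⟩)).2 p hp R)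

/-- **The same witness with an EXACT Kerr d.o.c. (`IsKerrDoc`) in place of `0`-closeness** — the form in which the paper
witness (maximal Schwarzschild perturbed in the second exterior) is naturally certified. [folklore] -/
theorem kerrIsolation_false_of_isKerrDoc_closureWitness
    (hW : ∃ (Λ : ℝ≥0) (r₀ : ℝ), 0 < r₀ ∧ ∃ (m₀ M₁ θ : ℝ), 0 < m₀ ∧ 0 < θ ∧
      ∃ (𝓢 : Spacetime.{0} 4) (E : EndDatum 𝓢) (M a : ℝ), E.IsTameEnd Λ r₀ ∧ E.IsSilent ∧
        m₀ ≤ M ∧ M ≤ M₁ ∧ |a| ≤ (1 - θ) * M ∧ IsKerrDoc 𝓢 E.doc M a ∧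
          ∃ p ∈ closure E.doc, ∃ R : ℝ, kerrDev 𝓢 p R ≠ 0) :
    ¬ ∀ (Λ : ℝ≥0) (r₀ : ℝ), 0 < r₀ → ∀ (m₀ M₁ θ : ℝ), 0 < m₀ → 0 < θ →
      ∃ δ₀ : ℝ≥0∞, 0 < δ₀ ∧ ∀ (𝓢 : Spacetime.{0} 4) (E : EndDatum 𝓢), E.IsTameEnd Λ r₀ →
        E.IsSilent →
          ((∃ M a : ℝ, m₀ ≤ M ∧ M ≤ M₁ ∧ |a| ≤ (1 - θ) * M ∧ E.IsGloballyClose M a δ₀) ∨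
              E.IsGloballyFlat δ₀) →
            ((∃ M a : ℝ, 0 < M ∧ |a| < M ∧ IsKerrDoc 𝓢 E.doc M a) ∨ IsMinkowski 𝓢) ∧
              ∀ p ∈ closure E.doc, ∀ R : ℝ, kerrDev 𝓢 p R = 0 := by
  obtain ⟨Λ, r₀, hr₀, m₀, M₁, θ, hm₀, hθ, 𝓢, E, M, a, htame, hsil, hmM, hMM, ha, hdoc, p, hp, R, hR⟩ := hW
  exact kerrIsolation_false_of_closureWitness ⟨Λ, r₀, hr₀, m₀, M₁, θ, hm₀, hθ, 𝓢, E, M, a, htame, hsil, hmM, hMM,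
    ha, isGloballyClose_of_isKerrDoc E hdoc 0, p, hp, R, hR⟩

end Summit.FinalStateConjecture.FinalStateConjecture.Theorems.ChannelsResolveTameDevelopmentsR.Negative

end
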